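import Literature.Computability.Complexity.IKWSimulationMachine
import Literature.Computability.Complexity.MurrayWilliams2018StringComplexity
import Literature.Computability.Complexity.Williams2014MachineB
import HarnessLib

/-!
# Murray–Williams 2018, Lemma 4.1: the derandomised advice-taking simulation `N` — the machine

Literature / circuit complexity — derandomization. The MACHINE half of the one ingredient of the
proof of Murray–Williams' Easy Witness Lemma for low nondeterministic time (C. D. Murray,
R. R. Williams, STOC 2018 = SIAM J. Comput. 49(5), 2020, Lemma 4.1; named fact
`MurrayWilliams2018_lemma_4_1_ae`, assembled in `MurrayWilliams2018EasyWitnessAssembly.lean` from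
Theorem 3.1 and the hypothesis `hsim`) that is neither Theorem 3.1 nor Umans' generator: the
nondeterministic algorithm `N` of the printed proof (SIAM p. 315):

> On inputs `x` of length `nᵢ` and inputs `x` of length `s′₂(nᵢ)`, `N` first guesses a string
> `y_hard` of length `O(t(nᵢ))` and runs `V(x_hard, y_hard)`. If `V` rejects, then `N` rejects.
> Otherwise, `N` will use `y_hard` as a hard function in the pseudorandom generator `G(·,·)` …
> `N` nondeterministically guesses an input `z` and enumerates all … seeds to the generator
> `G(y_hard, ·)` … Finally, `N` computes the probability that `Cₓ(y_hard, rⱼ)` accepts over all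
> `j`. If this probability is greater than `1/2`, then `N` accepts, else it rejects.

with the advice (`x_hard` and the protocol's advice `α`) folded into the input as a pair
`X = ⟨x, β⟩`, `β = ⟨⟨x_hard, α⟩, padding⟩`, over the tree's verifier-form `NTIME`
(`Nondeterministic.lean`) and its `FP` brick algebra, on the model of the machine of IKW's
Theorem 12 (`IKWSimulationMachine.lean`, whose bricks are reused). For a referee `Ref`
(Arthur's predicate, a language read on `⟨⟨x, α⟩, enc (z, r)⟩` as in `MAPromiseAdvice` /
`AdvisedMAGame`), a string function `F` (the generator, read on `⟨⟨Y, 1ˢ⟩, seed⟩`), a seed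
constant `g`, a size exponent `k₁`, a time bound `t`, a move length `m` and a verifier
`V : NVerifier t L` (`Williams2014Transfer.lean`):

* **Stage 1, the clocks** (`exists_clock_machine`): `X ↦ ⟨pre X, 1^{window X}⟩` with
  `pre X = ⟨⟨x_h, 1^{T(n)}⟩, ⟨⟨x, 1^{m ℓ}⟩, β⟩⟩`, `T(n) = c_V t(n) + c_V` the admissible witness
  length of `V` at `n = |x_h|`, `ℓ = |x|`, and the witness window `window X = 2 T(n) + 2 + m ℓ` — the
  unary clocks of the time-constructible `m` and `c_V t + c_V`
  (`exists_unaryClock_of_timeConstructible`) run under `mapFstAux` on `x` and on `x_h`;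
* **Stage 3, the preparation** (`bodyPrepF`): `⟨pre X, z'⟩ ↦ ⟨⟨x_h, y⟩, R⟩`, `y = (fst z') ↾ T(n)` the
  hard witness cut to the admissible length, `R = ⟨⟨x, α⟩, ⟨z, ⟨1^{m ℓ}, y⟩⟩⟩` the verdict's record,
  `z = takeD (m ℓ) (snd z')` Merlin's message;
* **the verifier `V`** on `⟨x_h, y⟩` under `mapFstAux` (its own time bound applies, `y` being
  admissible);
* **Stage 4, the verdict** (`postF`): reject unless `V` accepted; else the counted fold over the
  `2^σ` seeds, `σ = g (⌊log₂ |y|⌋ + 1)`, of the bits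
  `[⟨⟨x, α⟩, enc (z, (F ⟨⟨y, 1^S⟩, ρᵢ⟩) ↾ m ℓ)⟩ ∈ Ref]`, `S = (ℓ + m ℓ)^{k₁}` the target size of the
  generator, and the comparison `[2^σ < 2 · count]`;
* `verdictBit` — the input/output behaviour as a Boolean function of `(X, z')`;
  `exists_body_machine`; `simLang` — the pair language `N'`; and
  **`exists_simLang_mem_NTIME`**: there is `k` (before `t`, `m`, `V`: the degree of the clock- and
  verifier-independent shape polynomial) such that for all time-constructible monotone `t`,
  time-constructible `m ≤ t` a.e. and verifiers `V`, `simLang ∈ NTIME(tᵉ)` for every `e ≥ k`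
  (`mem_NTIME_of_prefixMachine_pre`, `Williams2014MachineB.lean`; `ℓ, n ≤ |X|`, `t` monotone,
  `|X| ≤ t |X|`).

The correctness (pseudorandomness for hard `y`, the `2/3`–`1/3` gap, the advice) and the
hypothesis `hsim` of the assembly are in `MurrayWilliams2018SimulationProofs.lean`.
Everything is proved; definitions with bodies only; no named fact is introduced (D-0026).

Relation to `MurrayWilliams2018Simulation.lean` (`MWSim.*`, landed while this file was in
review): that file fixes the BEHAVIOUR of the same algorithm `N` with an abstract interface — an
arbitrary kept length `U |w|`, move length `mv |x|`, output length `Nb |x| |α|`, the witness padded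
to a table of `2^M` bits fed to a table generator `tableGenerator F` with seeds of length `γ M` —
and proves its correctness on the good lengths; it has no machine. The present `MWSimN.verdictBit`
is the variant in which every such parameter is the one the MACHINE computes (the window from the
unary clocks of `m` and `c_V t + c_V`, the target size `S = (ℓ + m ℓ)^{k₁}` from the two rulers,
the generator read on `⟨⟨y, 1^S⟩, seed⟩` with seeds of length `g (⌊log₂ |y|⌋ + 1)`), which is what
the running-time analysis below needs; the IKW analogues `IKWSim.*` derandomise `MA` without
advice at the exponential scale with a generated table in place of the guessed hard witness.

## References

* C. D. Murray, R. R. Williams, *Circuit lower bounds for nondeterministic quasi-polytime: an easy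
  witness lemma for NP and NQP*, STOC 2018 = SIAM J. Comput. 49(5) (2020), proof of Lemma 4.1
  (SIAM pp. 315–316) [MurrayWilliams2018].
* R. Impagliazzo, V. Kabanets, A. Wigderson, *In search of an easy witness*, JCSS 65 (2002), §2.4
  (the nondeterministic simulation of `MA`) [ImpagliazzoKabanetsWigderson2002].
* S. Arora, B. Barak, *Computational Complexity: A Modern Approach*, CUP 2009, proof of
  Lemma 20.3 (enumerate all seeds, majority), §1.3, Def. 2.1/§2.1.2 [AroraBarakCC2009].
-/

noncomputable section

namespace Literature.Computability.Complexity

open _root_.Computability Turing Finset Filter Polynomial Brick Plumb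

namespace MWSimN

/-! ### Stage 4: the verdict (majority vote of Arthur's predicate over all seeds)

The verdict works on the record `R = ⟨⟨x, α⟩, ⟨z, ⟨U, y⟩⟩⟩` (input, protocol advice, Merlin's message,
the move length in unary `U = 1^{m ℓ}`, the hard witness); the pieces of the fold receive
`Z = ⟨R, 1ⁱ⟩`. -/

section Post

variable (Ref : Language Bool) (F : List Bool → List Bool) (g k₁ : ℕ)

/-- Field `⟨x, α⟩` of a piece argument `⟨R, 1ⁱ⟩`. [folklore] -/
def xaZ : List Bool → List Bool := fstF ∘ fstF
/-- Field `z` (Merlin's message) of a piece argument. [folklore] -/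
def zZ : List Bool → List Bool := fstF ∘ sndF ∘ fstF
/-- Field `U = 1^{m ℓ}` of a piece argument. [folklore] -/
def umZ : List Bool → List Bool := fstF ∘ sndF ∘ sndF ∘ fstF
/-- Field `y` (the hard witness) of a piece argument. [folklore] -/
def yZ : List Bool → List Bool := sndF ∘ sndF ∘ sndF ∘ fstF
/-- The seed ruler `1^{g (⌊log₂ |y|⌋ + 1)}` from a word `y`. [folklore] -/
def seedRuler : List Bool → List Bool := onesMulFn g ∘ List.cons true ∘ logFn

/-- The size ruler `1^{(ℓ + m ℓ)^{k₁}}` from `⟨x, α⟩` and `U`: `polyFn (X^{k₁})` of `x U`. [folklore] -/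
def sizeRuler : List Bool → List Bool := polyFn (X ^ k₁)

/-- The `i`-th seed `ρᵢ = takeD (g (⌊log₂ |y|⌋ + 1)) (bin i)`. [folklore] -/
def seedZ : List Bool → List Bool :=
  fstF ∘ padTakeFn ∘ fanoutFn (seedRuler g ∘ yZ) (lenBinF ∘ sndF)

/-- The size ruler on a piece argument: `1^{(|x| + |U|)^{k₁}}`. [folklore] -/
def sizeZ : List Bool → List Bool := sizeRuler k₁ ∘ fun w => fstF (xaZ w) ++ umZ w

/-- The generator's output on the `i`-th seed: `F ⟨⟨y, 1^S⟩, ρᵢ⟩`. [folklore] -/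
def outZ : List Bool → List Bool := F ∘ fanoutFn (fanoutFn yZ (sizeZ k₁)) (seedZ g)

/-- Arthur's coins in round `i`: the first `m ℓ = |U|` output bits, padded. [folklore] -/
def coinsZ : List Bool → List Bool := fstF ∘ padTakeFn ∘ fanoutFn umZ (outZ F g k₁)

/-- **The piece of round `i`**: the bit `[⟨⟨x, α⟩, enc (z, coinsᵢ)⟩ ∈ Ref]` as a one-symbol string.
[folklore] -/
def pieceZ : List Bool → List Bool :=
  (fun w => encodeBool ((AMTwo.toRefFn ⁻¹' Ref : Language Bool).boolIndicator w)) ∘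
    fanoutFn (fanoutFn xaZ zZ) (coinsZ F g k₁)

/-- Field `y` of the record `R`. [folklore] -/
def yR : List Bool → List Bool := sndF ∘ sndF ∘ sndF

/-- The number of seeds as a numeral: `R ↦ bin 2^{σ} = 0^{σ} 1`, `σ = g (⌊log₂ |y|⌋ + 1)`. [folklore] -/
def cntNumR : List Bool → List Bool := (fun w => Kannan.zerosFn w ++ [true]) ∘ seedRuler g ∘ yR

/-- The fold's initial record `R ↦ ⟨R, ⟨bin 2^σ, ⟨1⁰, bin 0⟩⟩⟩`. [folklore] -/
def initR : List Bool → List Bool :=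
  fanoutFn (fun w => w) (fanoutFn (cntNumR g) fun _ => boolPair [] [])

/-- The capacity polynomial of the fold: `(2X + 2)^g ≥ 2^{g (⌊log₂ |y|⌋ + 1)}` rounds. [folklore] -/
def capPoly : Polynomial ℕ := (2 * X + 2) ^ g

/-- **The number of accepting seeds**, as a numeral: the counted fold over `i < 2^σ`.
[folklore] -/
def accR : List Bool → List Bool :=
  sndPow 2 ∘ foldLoop addFn (clipF 1 (pieceZ Ref F g k₁)) (capPoly g) ∘ initR g

/-- **The verdict on a record**: `[2^σ < 2 · #accepting seeds]`. [folklore] -/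
def verdictR : List Bool → List Bool :=
  ltFn ∘ fanoutFn (cntNumR g) (addFn ∘ fanoutFn (accR Ref F g k₁) (accR Ref F g k₁))

/-- **Stage 4**: reject unless the verifier's bit (first component) is `1`, else the verdict on the
record (second component). [folklore] -/
def postF : List Bool → List Bool :=
  iteFn fstF (verdictR Ref F g k₁ ∘ sndF) fun _ => [false]

/-! #### Membership in `FP` -/

variable {Ref F}

/-- `xaZ ∈ FP`. [folklore] -/
theorem xaZ_mem_FP : xaZ ∈ FP := comp_mem_FP fstF_mem_FP fstF_mem_FP
/-- `zZ ∈ FP`. [folklore] -/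
theorem zZ_mem_FP : zZ ∈ FP := comp_mem_FP fstF_mem_FP (comp_mem_FP sndF_mem_FP fstF_mem_FP)
/-- `umZ ∈ FP`. [folklore] -/
theorem uZ_mem_FP : umZ ∈ FP :=
  comp_mem_FP fstF_mem_FP (comp_mem_FP sndF_mem_FP (comp_mem_FP sndF_mem_FP fstF_mem_FP))
/-- `yZ ∈ FP`. [folklore] -/
theorem yZ_mem_FP : yZ ∈ FP :=
  comp_mem_FP sndF_mem_FP (comp_mem_FP sndF_mem_FP (comp_mem_FP sndF_mem_FP fstF_mem_FP))
/-- `yR ∈ FP`. [folklore] -/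
theorem yR_mem_FP : yR ∈ FP := comp_mem_FP sndF_mem_FP (comp_mem_FP sndF_mem_FP sndF_mem_FP)

/-- `seedRuler ∈ FP`. [folklore] -/
theorem seedRuler_mem_FP : seedRuler g ∈ FP :=
  comp_mem_FP (onesMulFn_mem_FP g) (comp_mem_FP (cons_mem_FP true) logFn_mem_FP)

/-- `sizeRuler ∈ FP`. [folklore] -/
theorem sizeRuler_mem_FP : sizeRuler k₁ ∈ FP := polyFn_mem_FP _

/-- `seedZ ∈ FP`. [folklore] -/
theorem seedZ_mem_FP : seedZ g ∈ FP :=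
  comp_mem_FP fstF_mem_FP (comp_mem_FP padTakeFn_mem_FP
    (fanoutFn_mem_FP (comp_mem_FP (seedRuler_mem_FP g) yZ_mem_FP) (comp_mem_FP lenBinF_mem_FP sndF_mem_FP)))

/-- `sizeZ ∈ FP`. [folklore] -/
theorem sizeZ_mem_FP : sizeZ k₁ ∈ FP :=
  comp_mem_FP (sizeRuler_mem_FP k₁) (append_mem_FP (comp_mem_FP fstF_mem_FP xaZ_mem_FP) uZ_mem_FP)

/-- `outZ ∈ FP` for `F ∈ FP`. [folklore] -/
theorem outZ_mem_FP (hF : F ∈ FP) : outZ F g k₁ ∈ FP :=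
  comp_mem_FP hF (fanoutFn_mem_FP (fanoutFn_mem_FP yZ_mem_FP (sizeZ_mem_FP k₁)) (seedZ_mem_FP g))

/-- `coinsZ ∈ FP` for `F ∈ FP`. [folklore] -/
theorem coinsZ_mem_FP (hF : F ∈ FP) : coinsZ F g k₁ ∈ FP :=
  comp_mem_FP fstF_mem_FP (comp_mem_FP padTakeFn_mem_FP
    (fanoutFn_mem_FP uZ_mem_FP (outZ_mem_FP g k₁ hF)))

/-- `pieceZ ∈ FP` for `Ref ∈ P`, `F ∈ FP`. [folklore] -/
theorem pieceZ_mem_FP (hRef : Ref ∈ Classes.P) (hF : F ∈ FP) : pieceZ Ref F g k₁ ∈ FP :=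
  comp_mem_FP (indicatorFn_mem_FP (preimage_mem_P hRef AMTwo.toRefFn_mem_FP))
    (fanoutFn_mem_FP (fanoutFn_mem_FP xaZ_mem_FP zZ_mem_FP) (coinsZ_mem_FP g k₁ hF))

/-- `cntNumR ∈ FP`. [folklore] -/
theorem cntNumR_mem_FP : cntNumR g ∈ FP :=
  comp_mem_FP (append_mem_FP Kannan.zerosFn_mem_FP (const_mem_FP [true]))
    (comp_mem_FP (seedRuler_mem_FP g) yR_mem_FP)

/-- `initR ∈ FP`. [folklore] -/
theorem initR_mem_FP : initR g ∈ FP :=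
  fanoutFn_mem_FP (PolyTimeComputable.id _) (fanoutFn_mem_FP (cntNumR_mem_FP g) (const_mem_FP _))

/-- **`accR ∈ FP`**. [folklore] -/
theorem accR_mem_FP (hRef : Ref ∈ Classes.P) (hF : F ∈ FP) : accR Ref F g k₁ ∈ FP :=
  comp_mem_FP (sndPow_mem_FP 2)
    (comp_mem_FP (foldLoop_clipF_mem_FP 1 addFn_mem_FP length_addFn_le (pieceZ_mem_FP g k₁ hRef hF) _)
      (initR_mem_FP g))

/-- `verdictR ∈ FP`. [folklore] -/
theorem verdictR_mem_FP (hRef : Ref ∈ Classes.P) (hF : F ∈ FP) : verdictR Ref F g k₁ ∈ FP :=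
  comp_mem_FP ltFn_mem_FP (fanoutFn_mem_FP (cntNumR_mem_FP g)
    (comp_mem_FP addFn_mem_FP
      (fanoutFn_mem_FP (accR_mem_FP g k₁ hRef hF) (accR_mem_FP g k₁ hRef hF))))

/-- **`postF ∈ FP`** for `Ref ∈ P`, `F ∈ FP`. [folklore] -/
theorem postF_mem_FP (hRef : Ref ∈ Classes.P) (hF : F ∈ FP) : postF Ref F g k₁ ∈ FP :=
  iteFn_mem_FP fstF_mem_FP (comp_mem_FP (verdictR_mem_FP g k₁ hRef hF) sndF_mem_FP) (const_mem_FP _)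

/-! #### Values -/

variable (Ref F)
variable (x α z U y : List Bool)

/-- The record. [folklore] -/
abbrev recR : List Bool := boolPair (boolPair x α) (boolPair z (boolPair U y))

/-- Field `⟨x, α⟩` on a piece argument. [folklore] -/
@[simp] theorem xaZ_rec (i : List Bool) : xaZ (boolPair (recR x α z U y) i) = boolPair x α := by
  simp [xaZ, fstF]
/-- Field `z` on a piece argument. [folklore] -/
@[simp] theorem zZ_rec (i : List Bool) : zZ (boolPair (recR x α z U y) i) = z := by
  simp [zZ, fstF, sndF]
/-- Field `U` on a piece argument. [folklore] -/
@[simp] theorem uZ_rec (i : List Bool) : umZ (boolPair (recR x α z U y) i) = U := by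
  simp [umZ, fstF, sndF]
/-- Field `y` on a piece argument. [folklore] -/
@[simp] theorem yZ_rec (i : List Bool) : yZ (boolPair (recR x α z U y) i) = y := by
  simp [yZ, fstF, sndF]
/-- Field `y` on a record. [folklore] -/
@[simp] theorem yR_rec : yR (recR x α z U y) = y := by simp [yR, sndF]

/-- The seed length of a witness `y`: `σ = g (⌊log₂ |y|⌋ + 1)` (so `2^σ` seeds). [folklore] -/
abbrev seedLen (y : List Bool) : ℕ := g * (Nat.log 2 y.length + 1)

/-- Value of the seed ruler. [folklore] -/
@[simp] theorem seedRuler_apply (w : List Bool) : seedRuler g w = ones (seedLen g w) := by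
  simp [seedRuler, logFn, onesMulFn, ones]

/-- The size parameter `S = (ℓ + m ℓ)^{k₁}` read off `x` and `U`. [folklore] -/
abbrev sizeParam (x U : List Bool) : ℕ := (x.length + U.length) ^ k₁

/-- Value of `seedZ` in round `i`. [folklore] -/
theorem seedZ_rec (i : ℕ) :
    seedZ g (boolPair (recR x α z U y) (ones i)) = List.takeD (seedLen g y) (encodeNat i) false := by
  simp [seedZ, ones]

/-- Value of `sizeZ`. [folklore] -/
theorem sizeZ_rec (i : List Bool) :
    sizeZ k₁ (boolPair (recR x α z U y) i) = ones (sizeParam k₁ x U) := by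
  simp [sizeZ, sizeRuler, fstF]

/-- Value of `outZ` in round `i`. [folklore] -/
theorem outZ_rec (i : ℕ) :
    outZ F g k₁ (boolPair (recR x α z U y) (ones i)) =
      F (boolPair (boolPair y (ones (sizeParam k₁ x U))) (List.takeD (seedLen g y) (encodeNat i) false)) := by
  simp only [outZ, Function.comp_apply, fanoutFn_apply, yZ_rec, sizeZ_rec, seedZ_rec]

/-- Value of `coinsZ` in round `i`. [folklore] -/
theorem coinsZ_rec (i : ℕ) :
    coinsZ F g k₁ (boolPair (recR x α z U y) (ones i)) = List.takeD U.length
      (F (boolPair (boolPair y (ones (sizeParam k₁ x U)))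
        (List.takeD (seedLen g y) (encodeNat i) false))) false := by
  simp [coinsZ, outZ_rec]

/-- **Value of the piece of round `i`**: the bit `[⟨⟨x, α⟩, enc (z, coinsᵢ)⟩ ∈ Ref]`. [folklore] -/
theorem pieceZ_rec (i : ℕ) :
    pieceZ Ref F g k₁ (boolPair (recR x α z U y) (ones i)) =
      [Ref.boolIndicator (boolPair (boolPair x α) (encMoves [z, List.takeD U.length
        (F (boolPair (boolPair y (ones (sizeParam k₁ x U)))
          (List.takeD (seedLen g y) (encodeNat i) false))) false]))] := by
  simp only [pieceZ, Function.comp_apply, fanoutFn_apply, xaZ_rec, zZ_rec, coinsZ_rec, encodeBool]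
  congr 1
  change (Ref.boolIndicator ∘ AMTwo.toRefFn) _ = _
  rw [Function.comp_apply, AMTwo.toRefFn_apply]

/-- The piece is one symbol long on every input. [folklore] -/
theorem length_pieceZ (w : List Bool) : (pieceZ Ref F g k₁ w).length = 1 := by
  simp [pieceZ, encodeBool]

/-- Value of `cntNumR`: the numeral of `2^σ`. [folklore] -/
theorem cntNumR_rec : cntNumR g (recR x α z U y) = encodeNat (2 ^ seedLen g y) := by
  simp [cntNumR, ones, Com.encodeNat_two_pow]

/-- Value of `initR`. [folklore] -/
theorem initR_rec : initR g (recR x α z U y) =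
    boolPair (recR x α z U y) (boolPair (encodeNat (2 ^ seedLen g y)) (boolPair (ones 0) (encodeNat 0))) := by
  simp [initR, cntNumR_rec, ones]
  rfl

/-- **The number of accepting seeds** for the record: the number of `i < 2^σ` whose seed `ρᵢ` makes
Arthur accept. [folklore] -/
def accCount : ℕ :=
  ∑ i ∈ Finset.range (2 ^ seedLen g y),
    (Ref.boolIndicator (boolPair (boolPair x α) (encMoves [z, List.takeD U.length
      (F (boolPair (boolPair y (ones (sizeParam k₁ x U)))
        (List.takeD (seedLen g y) (encodeNat i) false))) false]))).toNat

/-- `2^σ ≤ (2 |R| + 2)^g`: the record is long enough for all rounds. [folklore] -/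
theorem two_pow_seedLen_le : 2 ^ seedLen g y ≤ (capPoly g).eval (recR x α z U y).length := by
  simp only [capPoly, eval_pow, eval_add, eval_mul, eval_ofNat, eval_X, seedLen]
  rw [pow_mul']
  refine Nat.pow_le_pow_left ?_ g
  have hy : y.length ≤ (recR x α z U y).length := by simp only [length_boolPair]; omega
  calc 2 ^ (Nat.log 2 y.length + 1) = 2 * 2 ^ Nat.log 2 y.length := by rw [pow_succ, mul_comm]
    _ ≤ 2 * (y.length + 1) := Nat.mul_le_mul_left 2 (Nat.pow_log_le_add_one 2 _)
    _ ≤ 2 * (recR x α z U y).length + 2 := by omega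

/-- **Value of `accR`**. [folklore] -/
theorem accR_rec : accR Ref F g k₁ (recR x α z U y) = encodeNat (accCount Ref F g k₁ x α z U y) := by
  have hk := two_pow_seedLen_le g x α z U y
  simp only [accR, Function.comp_apply, initR_rec]
  rw [foldLoop_apply addFn _ hk 0 (encodeNat 0), sndPow_succ_boolPair, sndPow_succ_boolPair,
    sndPow_zero_boolPair, foldAcc_clipF (fun i _ _ => by rw [length_pieceZ]; omega), foldAcc_addFn]
  have hb : ∀ b : Bool, bitsToNat [b] = b.toNat := fun b => by rw [bitsToNat_cons]; simp
  simp only [zero_add, accCount, pieceZ_rec, hb]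

/-- **Value of the verdict** on a record: `[2^σ < 2 · accCount]`. [folklore] -/
theorem verdictR_rec : verdictR Ref F g k₁ (recR x α z U y) =
    [decide (2 ^ seedLen g y < 2 * accCount Ref F g k₁ x α z U y)] := by
  simp [verdictR, cntNumR_rec, accR_rec, two_mul]

/-- **Value of stage 4 on a rejected witness**: reject. [folklore] -/
theorem postF_false (R : List Bool) : postF Ref F g k₁ (boolPair [false] R) = [false] := by
  rw [postF, iteFn_apply_false (by simp [fstF])]

/-- **Value of stage 4 on an accepted witness**: the verdict. [folklore] -/
theorem postF_true : postF Ref F g k₁ (boolPair [true] (recR x α z U y)) =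
    [decide (2 ^ seedLen g y < 2 * accCount Ref F g k₁ x α z U y)] := by
  rw [postF, iteFn_apply_true (by simp [fstF]), Function.comp_apply, sndF_boolPair, verdictR_rec]

end Post

/-! ### The fields of an advised input `X = ⟨x, β⟩`, `β = ⟨⟨x_h, α⟩, junk⟩` -/

/-- The input `x` of an advised input `X` (first component). [folklore] -/
def xIn (X : List Bool) : List Bool := fstF X
/-- The advice `β` of an advised input `X` (what the pair reader leaves). [folklore] -/
def advIn (X : List Bool) : List Bool := PairFstTM.readRest X
/-- The bad input `x_h` carried by the advice. [folklore] -/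
def xhIn (X : List Bool) : List Bool := fstF (fstF (PairFstTM.readRest X))
/-- The protocol's advice `α` carried by the advice. [folklore] -/
def alphaIn (X : List Bool) : List Bool := sndF (fstF (PairFstTM.readRest X))

/-- `xIn ⟨x, β⟩ = x`. [folklore] -/
@[simp] theorem xIn_boolPair (x β : List Bool) : xIn (boolPair x β) = x := by simp [xIn, fstF]
/-- `advIn ⟨x, β⟩ = β`. [folklore] -/
@[simp] theorem advIn_boolPair (x β : List Bool) : advIn (boolPair x β) = β := by simp [advIn]
/-- `xhIn ⟨x, ⟨⟨x_h, α⟩, j⟩⟩ = x_h`. [folklore] -/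
@[simp] theorem xhIn_boolPair (x xh α j : List Bool) :
    xhIn (boolPair x (boolPair (boolPair xh α) j)) = xh := by simp [xhIn, fstF]
/-- `alphaIn ⟨x, ⟨⟨x_h, α⟩, j⟩⟩ = α`. [folklore] -/
@[simp] theorem alphaIn_boolPair (x xh α j : List Bool) :
    alphaIn (boolPair x (boolPair (boolPair xh α) j)) = α := by simp [alphaIn, fstF, sndF]

/-- `|xIn X| ≤ |X|`. [folklore] -/
theorem length_xIn_le (X : List Bool) : (xIn X).length ≤ X.length := length_boolUnpair_fst_le X
/-- `|advIn X| ≤ |X|`. [folklore] -/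
theorem length_advIn_le (X : List Bool) : (advIn X).length ≤ X.length := by
  have := PairFstTM.readSteps_add_le X; have := PairFstTM.one_le_readSteps X; unfold advIn; omega
/-- `|xhIn X| ≤ |X|`. [folklore] -/
theorem length_xhIn_le (X : List Bool) : (xhIn X).length ≤ X.length :=
  ((length_boolUnpair_fst_le _).trans (length_boolUnpair_fst_le _)).trans (length_advIn_le X)

/-! ### The preprocessed word and the witness window -/

section Pre

variable (t m : ℕ → ℕ) (cV : ℕ)

/-- The admissible witness length of the verifier `V` at the bad input: `T(n) = c_V t(n) + c_V`,
`n = |x_h|`. [folklore] -/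
abbrev wlen (X : List Bool) : ℕ := cV * t (xhIn X).length + cV

/-- **The preprocessed word** `pre X = ⟨⟨x_h, 1^{T(n)}⟩, ⟨⟨x, 1^{m ℓ}⟩, β⟩⟩`: the bad input with the
admissible witness length of `V` in unary, the input with the move length in unary, the advice.
[folklore] -/
def pre (X : List Bool) : List Bool :=
  boolPair (boolPair (xhIn X) (ones (wlen t cV X)))
    (boolPair (boolPair (xIn X) (ones (m (xIn X).length))) (advIn X))

/-- **The witness window** `s X = 2 T(n) + 2 + m ℓ`: room for a pair `⟨y, z⟩` of an admissible
witness `y` of `V` and a message `z` of Merlin. [folklore] -/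
def window (X : List Bool) : ℕ := 2 * wlen t cV X + 2 + m (xIn X).length

end Pre

/-! ### Stage 3: the preparation of the body -/

section Prep

/-- On the body's input `⟨pre X, z'⟩`: the field `x_h`. [folklore] -/
def xhB : List Bool → List Bool := fstF ∘ fstF ∘ fstF
/-- The ruler `1^{T(n)}`. [folklore] -/
def utB : List Bool → List Bool := sndF ∘ fstF ∘ fstF
/-- The word `⟨⟨x, 1^{m ℓ}⟩, β⟩`. [folklore] -/
def w0B : List Bool → List Bool := sndF ∘ fstF
/-- The field `x`. [folklore] -/
def xB : List Bool → List Bool := fstF ∘ fstF ∘ w0B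
/-- The ruler `1^{m ℓ}`. [folklore] -/
def umB : List Bool → List Bool := sndF ∘ fstF ∘ w0B
/-- The field `α`. [folklore] -/
def alphaB : List Bool → List Bool := sndF ∘ fstF ∘ sndF ∘ w0B
/-- The truncated witness `z'`. [folklore] -/
def zpB : List Bool → List Bool := sndF
/-- **The hard witness** `y = (fst z') ↾ T(n)` (cut to the admissible length of `V`). [folklore] -/
def yB : List Bool → List Bool := takeFn ∘ fanoutFn utB (fstF ∘ zpB)
/-- **Merlin's message** `z = takeD (m ℓ) (snd z')` (normalised to the move length). [folklore] -/
def zB : List Bool → List Bool := fstF ∘ padTakeFn ∘ fanoutFn umB (sndF ∘ zpB)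

/-- **Stage 3**: `⟨pre X, z'⟩ ↦ ⟨⟨x_h, y⟩, ⟨⟨x, α⟩, ⟨z, ⟨1^{m ℓ}, y⟩⟩⟩⟩` — the pair for the verifier
`V` in front, the verdict's record behind. [folklore] -/
def bodyPrepF : List Bool → List Bool :=
  fanoutFn (fanoutFn xhB yB) (fanoutFn (fanoutFn xB alphaB) (fanoutFn zB (fanoutFn umB yB)))

/-- `bodyPrepF ∈ FP`. [folklore] -/
theorem prepF_mem_FP : bodyPrepF ∈ FP := by
  have hw0 : w0B ∈ FP := comp_mem_FP sndF_mem_FP fstF_mem_FP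
  have hxh : xhB ∈ FP := comp_mem_FP fstF_mem_FP (comp_mem_FP fstF_mem_FP fstF_mem_FP)
  have hut : utB ∈ FP := comp_mem_FP sndF_mem_FP (comp_mem_FP fstF_mem_FP fstF_mem_FP)
  have hx : xB ∈ FP := comp_mem_FP fstF_mem_FP (comp_mem_FP fstF_mem_FP hw0)
  have hum : umB ∈ FP := comp_mem_FP sndF_mem_FP (comp_mem_FP fstF_mem_FP hw0)
  have hα : alphaB ∈ FP := comp_mem_FP sndF_mem_FP (comp_mem_FP fstF_mem_FP (comp_mem_FP sndF_mem_FP hw0))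
  have hy : yB ∈ FP :=
    comp_mem_FP takeFn_mem_FP (fanoutFn_mem_FP hut (comp_mem_FP fstF_mem_FP sndF_mem_FP))
  have hz : zB ∈ FP := comp_mem_FP fstF_mem_FP (comp_mem_FP padTakeFn_mem_FP
    (fanoutFn_mem_FP hum (comp_mem_FP sndF_mem_FP sndF_mem_FP)))
  exact fanoutFn_mem_FP (fanoutFn_mem_FP hxh hy)
    (fanoutFn_mem_FP (fanoutFn_mem_FP hx hα) (fanoutFn_mem_FP hz (fanoutFn_mem_FP hum hy)))

variable (xh UT x Um β zp : List Bool)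

/-- The body's input for the preprocessed word with the displayed fields. [folklore] -/
abbrev bodyIn : List Bool :=
  boolPair (boolPair (boolPair xh UT) (boolPair (boolPair x Um) β)) zp

/-- The hard witness read off the body's input. [folklore] -/
@[simp] theorem yB_bodyIn : yB (bodyIn xh UT x Um β zp) = (fstF zp).take UT.length := by
  simp [yB, utB, zpB, fstF, sndF]

/-- Merlin's message read off the body's input. [folklore] -/
@[simp] theorem zB_bodyIn : zB (bodyIn xh UT x Um β zp) = List.takeD Um.length (sndF zp) false := by
  simp [zB, umB, w0B, zpB, fstF, sndF]

/-- **Value of stage 3.** [folklore] -/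
theorem prepF_bodyIn : bodyPrepF (bodyIn xh UT x Um β zp) =
    boolPair (boolPair xh ((fstF zp).take UT.length))
      (recR x (sndF (fstF β)) (List.takeD Um.length (sndF zp) false) Um ((fstF zp).take UT.length)) := by
  simp [bodyPrepF, xhB, xB, alphaB, umB, w0B, fstF, sndF]

end Prep

/-! ### The body: preparation, the verifier `V` on `⟨x_h, y⟩`, the verdict -/

section Body

variable (Ref : Language Bool) (F : List Bool → List Bool) (g k₁ : ℕ)

section VerdictBit

variable (t m : ℕ → ℕ) {L : Language Bool} (V : NVerifier t L)

/-- **The behaviour of the simulating verifier** on the advised input `X` and the (truncated)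
witness `z'`: the hard witness `y = (fst z') ↾ T(n)` must be accepted by `V` on the bad input
`x_h`, and then a majority of the `2^σ` seeds must make Arthur accept
`⟨⟨x, α⟩, enc (z, G_y(ρᵢ) ↾ m ℓ)⟩`, `z = takeD (m ℓ) (snd z')`. [folklore] -/
def verdictBit (X zp : List Bool) : Bool :=
  (V.rel (xhIn X) ((fstF zp).take (wlen t V.c X)) &&
    decide (2 ^ seedLen g ((fstF zp).take (wlen t V.c X)) <
      2 * accCount Ref F g k₁ (xIn X) (alphaIn X) (List.takeD (m (xIn X).length) (sndF zp) false)
        (ones (m (xIn X).length)) ((fstF zp).take (wlen t V.c X))))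

end VerdictBit

variable {Ref F}

/-- **The body machine** `M_prep ∘ mapFstAux V.machine ∘ M_post` on `⟨pre X, z'⟩`: it outputs the
verdict bit within `Q(|⟨pre X, z'⟩|) + (c_V t(n) + c_V)` steps — the hard witness handed to `V`
is cut to its admissible length, so `V`'s own time bound applies. [folklore] -/
theorem exists_body_machine (hRef : Ref ∈ Classes.P) (hF : F ∈ FP) :
    ∃ Q : Polynomial ℕ, ∀ (t m : ℕ → ℕ) {L : Language Bool} (V : NVerifier t L),
      ∃ S : TM2ComputableAux Bool Bool, ∀ X zp : List Bool,
      S.OutputsWithin (boolPair (pre t m V.c X) zp) [verdictBit Ref F g k₁ t m V X zp]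
        (Q.eval (boolPair (pre t m V.c X) zp).length + (V.c * t (xhIn X).length + V.c)) := by
  obtain ⟨p₃, M₃, hM₃⟩ := prepF_mem_FP
  obtain ⟨p₄, M₄, hM₄⟩ := postF_mem_FP g k₁ hRef hF
  set D₃ := TM2Comp.machinePushBound M₃.tm with hD₃
  set Lp : Polynomial ℕ := X + Polynomial.C D₃ * p₃ with hLp
  refine ⟨p₃ + 3 + 2 * Lp + 6 + p₄.comp (4 + Lp), fun t m L V => ⟨M₃.comp ((mapFstAux V.machine).comp M₄),
    fun Xw zp => ?_⟩⟩
  set Bw := boolPair (pre t m V.c Xw) zp with hBw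
  set xh := xhIn Xw with hxh
  set y := (fstF zp).take (wlen t V.c Xw) with hy
  set R := recR (xIn Xw) (alphaIn Xw) (List.takeD (m (xIn Xw).length) (sndF zp) false)
    (ones (m (xIn Xw).length)) y with hR
  -- stage 3
  have h₁ : M₃.OutputsWithin Bw (bodyPrepF Bw) (p₃.eval Bw.length) := hM₃ Bw
  have hℓ₁ : (bodyPrepF Bw).length ≤ Bw.length + D₃ * p₃.eval Bw.length :=
    TM2Comp.length_le_of_outputsWithin M₃ h₁
  have hpre : bodyPrepF Bw = boolPair (boolPair xh y) R := by
    rw [hBw, pre, prepF_bodyIn]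
    simp only [ones, List.length_replicate]
    rfl
  -- the verifier under `mapFstAux`
  have hylen : y.length ≤ V.c * t xh.length + V.c := by
    rw [hy]; exact (List.length_take_le _ _).trans le_rfl
  have hV : V.machine.OutputsWithin (boolUnpair (bodyPrepF Bw)).1 (encodeBool (V.rel xh y))
      (V.c * t xh.length + V.c) := by
    rw [hpre, boolUnpair_boolPair]
    exact V.outputsWithin xh y hylen
  have h₂ := outputsWithin_mapFstAux V.machine hV
  rw [hpre, readRest_boolPair] at h₂
  rw [← hpre] at h₂
  -- stage 4
  set mid := boolPair (encodeBool (V.rel xh y)) R with hmid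
  have h₃ : M₄.OutputsWithin mid (postF Ref F g k₁ mid) (p₄.eval mid.length) := hM₄ mid
  have hval : postF Ref F g k₁ mid = [verdictBit Ref F g k₁ t m V Xw zp] := by
    rw [hmid, verdictBit, ← hxh, ← hy]
    cases V.rel xh y with
    | false => rw [show encodeBool false = [false] from rfl, postF_false, Bool.false_and]
    | true => rw [show encodeBool true = [true] from rfl, hR, postF_true, Bool.true_and]
  rw [hval] at h₃
  have h := Turing.TM2ComputableAux.comp_outputsWithin _ _ h₁
    (Turing.TM2ComputableAux.comp_outputsWithin _ _ h₂ h₃)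
  refine h.mono ?_
  -- bookkeeping in `Z = |Bw|`
  have hL : (bodyPrepF Bw).length ≤ Lp.eval Bw.length := by
    simp only [hLp, eval_add, eval_X, eval_mul, eval_C]; exact hℓ₁
  have hRle : R.length ≤ (bodyPrepF Bw).length := by
    rw [hpre]; simp only [length_boolPair]; omega
  have hb : (encodeBool (V.rel xh y)).length = 1 := by cases V.rel xh y <;> rfl
  have hmidl : mid.length ≤ (4 + Lp).eval Bw.length := by
    rw [hmid, length_boolPair, hb]
    simp only [eval_add, eval_ofNat]
    omega
  have hpG : p₄.eval mid.length ≤ (p₄.comp (4 + Lp)).eval Bw.length := by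
    rw [eval_comp]; exact TM2Iter.eval_mono _ hmidl
  simp only [eval_add, eval_mul, eval_ofNat]
  rw [hb]
  omega

end Body

/-! ### Stage 1: the clocks (move length and admissible witness length in unary) -/

section Clock

/-- Between the two clocks: `⟨⟨x, 1^{m ℓ}⟩, β⟩ ↦ ⟨x_h, ⟨⟨x, 1^{m ℓ}⟩, β⟩⟩` (expose the bad input).
[folklore] -/
def midF : List Bool → List Bool := fanoutFn (fstF ∘ fstF ∘ sndF) fun w => w

/-- After the two clocks: `W ↦ ⟨W, 1^{2 T + 2 + m ℓ}⟩` (the witness window, read off the two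
rulers of `W = pre X`). [folklore] -/
def finF : List Bool → List Bool :=
  fanoutFn (fun w => w) (onesFn ∘ fanoutFn (sndF ∘ fstF) (sndF ∘ fstF ∘ sndF))

/-- `midF ∈ FP`. [folklore] -/
theorem midF_mem_FP : midF ∈ FP :=
  fanoutFn_mem_FP (comp_mem_FP fstF_mem_FP (comp_mem_FP fstF_mem_FP sndF_mem_FP)) (PolyTimeComputable.id _)

/-- `finF ∈ FP`. [folklore] -/
theorem finF_mem_FP : finF ∈ FP :=
  fanoutFn_mem_FP (PolyTimeComputable.id _) (comp_mem_FP onesFn_mem_FP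
    (fanoutFn_mem_FP (comp_mem_FP sndF_mem_FP fstF_mem_FP)
      (comp_mem_FP sndF_mem_FP (comp_mem_FP fstF_mem_FP sndF_mem_FP))))

/-- Value of `midF`. [folklore] -/
theorem midF_apply (x U β : List Bool) :
    midF (boolPair (boolPair x U) β) = boolPair (fstF (fstF β)) (boolPair (boolPair x U) β) := by
  simp [midF, fstF, sndF]

/-- Value of `finF`. [folklore] -/
theorem finF_apply (xh UT x Um β : List Bool) :
    finF (boolPair (boolPair xh UT) (boolPair (boolPair x Um) β)) =
      boolPair (boolPair (boolPair xh UT) (boolPair (boolPair x Um) β))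
        (ones (2 * UT.length + 2 + Um.length)) := by
  simp [finF, fstF, sndF, onesFn, OracleCompose.unaryEncodeNat_eq_replicate, ones]

/-- **The clock stage** `mapFstAux C_m ∘ M_mid ∘ mapFstAux C_T ∘ M_fin` on EVERY word `X`: it outputs
`⟨pre X, 1^{window X}⟩` within `P(|X| + m ℓ + T(n))` steps, for time-constructible `m` and `t`
(their unary clocks, `exists_unaryClock_of_timeConstructible`, run on `x` and on `x_h`).
[folklore] -/
theorem exists_clock_machine :
    ∃ P : Polynomial ℕ, ∀ (t m : ℕ → ℕ) (cV : ℕ), IsTimeConstructible m → IsTimeConstructible t →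
      1 ≤ cV → ∃ (C : ℕ) (N : TM2ComputableAux Bool Bool), ∀ X : List Bool,
      N.OutputsWithin X (boolPair (pre t m cV X) (List.replicate (window t m cV X) true))
        (C * P.eval (X.length + m (xIn X).length + wlen t cV X)) := by
  obtain ⟨p₁, M₁, hM₁⟩ := midF_mem_FP
  obtain ⟨p₂, M₂, hM₂⟩ := finF_mem_FP
  refine ⟨35 * X + 41 + p₁.comp (5 * X + 6) + p₂.comp (11 * X + 12), fun t m cV hm ht hcV => ?_⟩
  obtain ⟨Cm, am, hCm⟩ := exists_unaryClock_of_timeConstructible hm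
  obtain ⟨CT, aT, hCT⟩ := exists_unaryClock_of_timeConstructible (ht.mul_add hcV)
  refine ⟨am + aT + 1, (mapFstAux Cm).comp (M₁.comp ((mapFstAux CT).comp M₂)), fun Xw => ?_⟩
  set x := xIn Xw with hx
  set β := advIn Xw with hβ
  set ℓm := m x.length with hℓm
  set T := wlen t cV Xw with hT
  set W0 := boolPair (boolPair x (ones ℓm)) β with hW0
  set xh := xhIn Xw with hxh
  set W2 := boolPair (boolPair xh (ones T)) W0 with hW2
  -- clock of `m` on `x`
  have h0 : (mapFstAux Cm).OutputsWithin Xw W0 (am * ℓm + am + 3 * (boolPair x (ones ℓm)).length +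
      2 * Xw.length + 6) := by
    have hz : Cm.OutputsWithin (boolUnpair Xw).1 (boolPair x (ones ℓm)) (am * ℓm + am) := by
      have := hCm (boolUnpair Xw).1
      simpa [hx, xIn, fstF, hℓm, ones] using this
    have := outputsWithin_mapFstAux Cm hz
    rwa [show PairFstTM.readRest Xw = β by rw [hβ, advIn]] at this
  -- expose `x_h`
  have h1 : M₁.OutputsWithin W0 (boolPair xh W0) (p₁.eval W0.length) := by
    have := hM₁ W0
    rwa [hW0, midF_apply, ← hW0, show fstF (fstF β) = xh by rw [hxh, xhIn, hβ, advIn]] at this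
  -- clock of `T` on `x_h`
  have h2 : (mapFstAux CT).OutputsWithin (boolPair xh W0) W2
      (aT * T + aT + 3 * (boolPair xh (ones T)).length + 2 * (boolPair xh W0).length + 6) := by
    have hz : CT.OutputsWithin (boolUnpair (boolPair xh W0)).1 (boolPair xh (ones T)) (aT * T + aT) := by
      have := hCT xh
      rw [boolUnpair_boolPair]
      simpa [hT, wlen, hxh, ones] using this
    have := outputsWithin_mapFstAux CT hz
    rwa [readRest_boolPair] at this
  -- the window
  have h3 : M₂.OutputsWithin W2 (boolPair W2 (ones (2 * T + 2 + ℓm))) (p₂.eval W2.length) := by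
    have := hM₂ W2
    rwa [hW2, hW0, finF_apply, ← hW0, ← hW2, show (ones T).length = T by simp [ones],
      show (ones ℓm).length = ℓm by simp [ones]] at this
  have h := Turing.TM2ComputableAux.comp_outputsWithin _ _ h0
    (Turing.TM2ComputableAux.comp_outputsWithin _ _ h1
      (Turing.TM2ComputableAux.comp_outputsWithin _ _ h2 h3))
  change (_ : TM2ComputableAux Bool Bool).OutputsWithin Xw (boolPair W2 (ones (2 * T + 2 + ℓm))) _
  refine h.mono ?_
  -- bookkeeping in `Z = |X| + m ℓ + T`
  set Z := Xw.length + ℓm + T with hZ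
  have hxl : x.length ≤ Xw.length := length_xIn_le Xw
  have hβl : β.length ≤ Xw.length := length_advIn_le Xw
  have hxhl : xh.length ≤ Xw.length := length_xhIn_le Xw
  have hW0l : W0.length ≤ 5 * Z + 6 := by
    rw [hW0, length_boolPair, length_boolPair]; simp only [ones, List.length_replicate]; omega
  have hmidl : (boolPair xh W0).length ≤ 7 * Z + 8 := by rw [length_boolPair]; omega
  have hW2l : W2.length ≤ 11 * Z + 12 := by
    rw [hW2, length_boolPair, length_boolPair]; simp only [ones, List.length_replicate]; omega
  have hp₁ : p₁.eval W0.length ≤ (p₁.comp (5 * X + 6)).eval Z := by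
    rw [eval_comp]; exact TM2Iter.eval_mono _ (by simpa using hW0l)
  have hp₂ : p₂.eval W2.length ≤ (p₂.comp (11 * X + 12)).eval Z := by
    rw [eval_comp]; exact TM2Iter.eval_mono _ (by simpa using hW2l)
  have hl1 : (boolPair x (ones ℓm)).length ≤ 3 * Z + 2 := by
    rw [length_boolPair]; simp only [ones, List.length_replicate]; omega
  have hl2 : (boolPair xh (ones T)).length ≤ 3 * Z + 2 := by
    rw [length_boolPair]; simp only [ones, List.length_replicate]; omega
  have hℓmZ : ℓm ≤ Z := by omega
  have hTZ : T ≤ Z := by omega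
  have hXZ : Xw.length ≤ Z := by omega
  have ham : am * ℓm ≤ am * Z := Nat.mul_le_mul_left _ hℓmZ
  have haT : aT * T ≤ aT * Z := Nat.mul_le_mul_left _ hTZ
  set Pz := (35 * X + 41 + p₁.comp (5 * X + 6) + p₂.comp (11 * X + 12)).eval Z with hPz
  have hPz1 : Z + 1 ≤ Pz := by
    simp only [hPz, eval_add, eval_mul, eval_X, eval_ofNat]; omega
  have hPz2 : 34 * Z + 40 + (p₁.comp (5 * X + 6)).eval Z + (p₂.comp (11 * X + 12)).eval Z ≤ Pz := by
    simp only [hPz, eval_add, eval_mul, eval_X, eval_ofNat]; omega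
  have e1 : (am + aT + 1) * Pz = am * Pz + aT * Pz + Pz := by ring
  have ham' : am * (Z + 1) ≤ am * Pz := Nat.mul_le_mul_left _ hPz1
  have haT' : aT * (Z + 1) ≤ aT * Pz := Nat.mul_le_mul_left _ hPz1
  rw [e1]
  have e2 : am * (Z + 1) = am * Z + am := by ring
  have e3 : aT * (Z + 1) = aT * Z + aT := by ring
  omega

end Clock

/-! ### The simulating pair language and its nondeterministic time -/

section Language

variable (Ref : Language Bool) (F : List Bool → List Bool) (g k₁ : ℕ)

/-- **The simulating pair language** `N'`: advised inputs `X = ⟨x, β⟩` having a witness inside the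
window on which the simulating verifier accepts. [folklore] -/
def simLang (t m : ℕ → ℕ) {L : Language Bool} (V : NVerifier t L) : Language Bool :=
  {X | ∃ zp : List Bool, zp.length ≤ window t m V.c X ∧ verdictBit Ref F g k₁ t m V X zp = true}

variable {Ref F}

/-- An eventual bound is a bound up to an additive constant. [folklore] -/
theorem exists_add_const_of_eventually_le {u v : ℕ → ℕ} (h : ∀ᶠ n in atTop, u n ≤ v n) :
    ∃ C : ℕ, ∀ n, u n ≤ v n + C := by
  obtain ⟨N, hN⟩ := eventually_atTop.1 h
  refine ⟨∑ i ∈ Finset.range N, u i, fun n => ?_⟩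
  rcases lt_or_ge n N with hn | hn
  · exact le_add_left (Finset.single_le_sum (fun i _ => Nat.zero_le (u i)) (Finset.mem_range.2 hn))
  · exact (hN n hn).trans (Nat.le_add_right _ _)

/-- `(u + 1)^A ≤ 2^A (u^A + 1)`. [folklore] -/
theorem succ_pow_le_two_pow_mul (u A : ℕ) : (u + 1) ^ A ≤ 2 ^ A * (u ^ A + 1) := by
  rcases Nat.eq_zero_or_pos u with rfl | hu
  · rw [zero_add, one_pow]
    exact Nat.one_le_iff_ne_zero.2 (Nat.mul_ne_zero (by positivity) (Nat.succ_ne_zero _))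
  · calc (u + 1) ^ A ≤ (2 * u) ^ A := Nat.pow_le_pow_left (by omega) A
      _ = 2 ^ A * u ^ A := by rw [mul_pow]
      _ ≤ 2 ^ A * (u ^ A + 1) := Nat.mul_le_mul_left _ (Nat.le_succ _)

/-- `u^A ≤ u^e + 1` for `A ≤ e` (also when `u = 0`). [folklore] -/
theorem pow_le_pow_add_one {u A e : ℕ} (h : A ≤ e) : u ^ A ≤ u ^ e + 1 := by
  rcases Nat.eq_zero_or_pos u with rfl | hu
  · rcases Nat.eq_zero_or_pos A with rfl | hA
    · simp
    · rw [zero_pow hA.ne']; exact Nat.zero_le _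
  · exact (Nat.pow_le_pow_right hu h).trans (Nat.le_succ _)

/-- **The simulating pair language is in `NTIME(tᵉ)` for every large `e`**: the clock stage costs a
polynomial in `|X| + m ℓ + T(n)`, the body a polynomial in `|pre X| + window X` plus `V`'s own
`c_V t(n) + c_V`; with `ℓ, n ≤ |X|`, `m ℓ ≤ t ℓ + O(1)` (from `m ≤ t` a.e.), `t` monotone and
`|X| ≤ t |X|`, everything is `O(t(|X|)^A)` for the total degree `A`, and `k = A` works.
[folklore] -/
theorem exists_simLang_mem_NTIME (hRef : Ref ∈ Classes.P) (hF : F ∈ FP) :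
    ∃ k : ℕ, 1 ≤ k ∧ ∀ (t m : ℕ → ℕ) {L : Language Bool} (V : NVerifier t L),
      IsTimeConstructible t → Monotone t → IsTimeConstructible m → (∀ᶠ n in atTop, m n ≤ t n) →
      1 ≤ V.c → ∀ e : ℕ, k ≤ e → simLang Ref F g k₁ t m V ∈ NTIME fun n => t n ^ e := by
  obtain ⟨P, hP⟩ := exists_clock_machine
  obtain ⟨Q, hQ⟩ := exists_body_machine g k₁ hRef hF
  -- the exponent: the degree of the (clock- and verifier-independent) shape polynomial
  obtain ⟨A, hA⟩ := EasyWitness.exists_const_eval_le (P + Q.comp (26 * X + 28) + 40 * X + 40)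
  refine ⟨A + 1, by omega, fun t m L V ht htmono hm hmt hc e he => ?_⟩
  obtain ⟨C, N, hN⟩ := hP t m V.c hm ht hc
  obtain ⟨S, hS⟩ := hQ t m V
  obtain ⟨M₀, hM₀⟩ := exists_add_const_of_eventually_le hmt
  obtain ⟨Cθ, hCθ⟩ : ∃ Cθ : ℕ, Cθ = V.c + M₀ + V.c + 2 := ⟨_, rfl⟩
  obtain ⟨K, hK⟩ : ∃ K : ℕ, K = (C + 1) * A * (Cθ ^ A * 2 ^ A) := ⟨_, rfl⟩
  refine mem_NTIME_of_prefixMachine_pre (pre t m V.c) (window t m V.c)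
    (verdictBit Ref F g k₁ t m V) N S
    (fun Xw => C * P.eval (Xw.length + m (xIn Xw).length + wlen t V.c Xw))
    (fun Xw => Q.eval (boolPair (pre t m V.c Xw) (List.replicate (window t m V.c Xw) true)).length +
      (V.c * t (xhIn Xw).length + V.c))
    hN (fun Xw zp hzp => ?_) (fun Xw => Iff.rfl) (2 * K + (C + 1) * A + V.c) (fun Xw => ?_)
  · -- the body on a witness inside the window
    have h := hS Xw zp
    have e1 : encodeBool (verdictBit Ref F g k₁ t m V Xw zp) = [verdictBit Ref F g k₁ t m V Xw zp] := by
      cases verdictBit Ref F g k₁ t m V Xw zp <;> rfl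
    rw [e1]
    refine h.mono (Nat.add_le_add_right (TM2Iter.eval_mono _ ?_) _)
    simp only [length_boolPair, List.length_replicate]
    omega
  · -- the total cost
    have hℓ : (xIn Xw).length ≤ Xw.length := length_xIn_le Xw
    have hn : (xhIn Xw).length ≤ Xw.length := length_xhIn_le Xw
    have hXt : Xw.length ≤ t Xw.length := ht.1 _
    have hmℓ : m (xIn Xw).length ≤ t Xw.length + M₀ :=
      (hM₀ _).trans (Nat.add_le_add_right (htmono hℓ) _)
    have hT : wlen t V.c Xw ≤ V.c * t Xw.length + V.c :=
      Nat.add_le_add_right (Nat.mul_le_mul_left _ (htmono hn)) _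
    -- `Λ = |X| + m ℓ + T ≤ Cθ Θ`
    obtain ⟨Λ, hΛ⟩ : ∃ Λ : ℕ, Λ = Xw.length + m (xIn Xw).length + wlen t V.c Xw := ⟨_, rfl⟩
    have hΛ' : Λ ≤ Cθ * (t Xw.length + 1) := by
      have e2 : Cθ * (t Xw.length + 1) = V.c * t Xw.length + M₀ * t Xw.length + V.c * t Xw.length +
          2 * t Xw.length + (V.c + M₀ + V.c + 2) := by rw [hCθ]; ring
      rw [e2, hΛ]
      have : 0 ≤ M₀ * t Xw.length := Nat.zero_le _
      omega
    have hpreL : (pre t m V.c Xw).length ≤ 12 * Λ + 12 := by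
      simp only [pre, length_boolPair, ones, List.length_replicate]
      have := length_advIn_le Xw
      omega
    have hwin : window t m V.c Xw ≤ 2 * Λ + 2 := by simp only [window]; omega
    have hbody : (boolPair (pre t m V.c Xw) (List.replicate (window t m V.c Xw) true)).length ≤
        26 * Λ + 28 := by
      rw [length_boolPair, List.length_replicate]; omega
    have hQ : Q.eval (boolPair (pre t m V.c Xw) (List.replicate (window t m V.c Xw) true)).length ≤
        (Q.comp (26 * X + 28)).eval Λ := by
      rw [eval_comp]; exact TM2Iter.eval_mono _ (by simpa using hbody)
    have hsum : C * P.eval Λ + (Q.comp (26 * X + 28)).eval Λ + (2 * Λ + 2) + (12 * Λ + 12) + Xw.length ≤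
        (C + 1) * (P + Q.comp (26 * X + 28) + 40 * X + 40).eval Λ := by
      simp only [eval_add, eval_mul, eval_ofNat, eval_X]
      have e0 : (C + 1) * (P.eval Λ + (Q.comp (26 * X + 28)).eval Λ + 40 * Λ + 40) =
          C * P.eval Λ + C * ((Q.comp (26 * X + 28)).eval Λ + 40 * Λ + 40) +
            (P.eval Λ + (Q.comp (26 * X + 28)).eval Λ + 40 * Λ + 40) := by ring
      rw [e0]
      have : 0 ≤ C * ((Q.comp (26 * X + 28)).eval Λ + 40 * Λ + 40) := Nat.zero_le _
      omega
    have hAΛ : (P + Q.comp (26 * X + 28) + 40 * X + 40).eval Λ ≤ A * (Cθ * (t Xw.length + 1)) ^ A + A := by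
      rcases Nat.eq_zero_or_pos Λ with h0 | hpos
      · have h1 : (P + Q.comp (26 * X + 28) + 40 * X + 40).eval Λ ≤
            (P + Q.comp (26 * X + 28) + 40 * X + 40).eval 1 := TM2Iter.eval_mono _ (by omega)
        refine h1.trans ((hA 1 le_rfl).trans (Nat.add_le_add_right (Nat.mul_le_mul_left _ ?_) _))
        rw [one_pow]
        exact Nat.one_le_pow _ _ (Nat.mul_pos (by omega) (by omega))
      · exact (TM2Iter.eval_mono _ hΛ').trans (hA _ (hpos.trans_le hΛ'))
    -- `(Cθ Θ)^A ≤ Cθ^A 2^A (t^e + 2)`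
    have hpow : (C + 1) * A * (Cθ * (t Xw.length + 1)) ^ A ≤ K * (t Xw.length ^ e + 2) := by
      rw [hK, mul_pow, mul_assoc ((C + 1) * A), mul_assoc (Cθ ^ A)]
      refine Nat.mul_le_mul_left _ (Nat.mul_le_mul_left _ ?_)
      refine (succ_pow_le_two_pow_mul _ _).trans (Nat.mul_le_mul_left _ ?_)
      exact Nat.add_le_add_right (pow_le_pow_add_one (by omega)) _
    have hAΛ' : (C + 1) * (P + Q.comp (26 * X + 28) + 40 * X + 40).eval Λ ≤
        (C + 1) * A * (Cθ * (t Xw.length + 1)) ^ A + (C + 1) * A := by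
      have := Nat.mul_le_mul_left (C + 1) hAΛ
      rwa [Nat.mul_add, ← Nat.mul_assoc] at this
    have hte : t Xw.length ≤ t Xw.length ^ e := by
      rcases Nat.eq_zero_or_pos (t Xw.length) with h0 | hpos
      · rw [h0]; exact Nat.zero_le _
      · exact Nat.le_self_pow (by omega) _
    have hVc : V.c * t (xhIn Xw).length ≤ V.c * t Xw.length ^ e :=
      (Nat.mul_le_mul_left _ (htmono hn)).trans (Nat.mul_le_mul_left _ hte)
    have e5 : K * (t Xw.length ^ e + 2) = K * t Xw.length ^ e + 2 * K := by ring
    have e6 : (2 * K + (C + 1) * A + V.c) * t Xw.length ^ e + (2 * K + (C + 1) * A + V.c) =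
        2 * (K * t Xw.length ^ e) + (C + 1) * A * t Xw.length ^ e + V.c * t Xw.length ^ e +
          (2 * K + (C + 1) * A + V.c) := by
      ring
    rw [e5] at hpow
    rw [e6, ← hΛ]
    have hz1 : 0 ≤ K * t Xw.length ^ e := Nat.zero_le _
    have hz2 : 0 ≤ (C + 1) * A * t Xw.length ^ e := Nat.zero_le _
    omega

end Language

end MWSimN

end Literature.Computability.Complexity

end
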